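import Mathlib.RingTheory.MvPolynomial.Homogeneous
import Mathlib.Algebra.MvPolynomial.Funext
import Mathlib.LinearAlgebra.CliffordAlgebra.Contraction
import Mathlib.LinearAlgebra.ExteriorAlgebra.Basis
import Mathlib.LinearAlgebra.Matrix.ToLin
import Mathlib.LinearAlgebra.QuadraticForm.Basic
import Mathlib.Data.Matrix.Basic
import HarnessLib

/-!
# Roy–Waldschmidt 1997, Lemme 7.6 (Clifford algebras): a matrix square root of a quadratic form

Support for the reduction of Roy–Waldschmidt's Théorème 0.2
(`Literature.NumberTheory.Transcendental.royWaldschmidt_quadratic_thm_0_2`, file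
`QuadraticRelationsLogarithms.lean`) to their Théorème 0.1 (sibling `…Proofs.lean`).

Roy–Waldschmidt, *Approximation diophantienne et indépendance algébrique de logarithmes*,
Ann. Sci. ÉNS 30 (1997), Lemme 7.6 (p. 793): for a homogeneous polynomial `q ∈ ℚ[X₁,…,X_m]` of
degree `2` there is an injective linear map `θ : ℂ^m → Mat_{2^m}(ℂ)` defined over `ℚ` whose ranks
are multiples of `2^{m-1}` and with `Z(q) = {det θ = 0}`; the proof lets `v ∈ ℚ^m` act by left
multiplication on the Clifford algebra `A₀` of `q|_{ℚ^m}` in a `ℚ`-basis of `A₀`, so that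
`θ(v)² = q(v)·1` ("Puisque `M_v²` est la matrice de la multiplication à gauche par `v² = q(v)·1`,
on a `M_v² = q(v)·1`", p. 793).

This file PROVES exactly the part of the lemma that the deduction of Théorème 0.2 consumes, in the
following export form (`exists_matrices_sq_eq_aeval`): for `P ∈ ℚ[X₁,…,Xₙ]` homogeneous of degree
`2` there are `D ≥ 1` and rational `D × D` matrices `C₁, …, Cₙ` such that, for every commutative
`ℚ`-algebra `A` and every `w ∈ Aⁿ`, `(∑ₖ wₖ Cₖ)² = P(w) · 1`.  Steps: a monomial of degree `2` is
`XᵢXⱼ` (`exists_eq_single_add_single`); hence `P(w) = ∑ c_m w_{i_m} w_{j_m}` over the support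
(`aeval_eq_sum_pairs`) and `v ↦ P(v)` is a quadratic form `q` on `ℚⁿ` (`exists_quadraticForm`);
the Clifford algebra of `q` is finite-dimensional with the basis transported from Mathlib's basis
of the exterior algebra (`Module.Basis.ExteriorAlgebra`, `CliffordAlgebra.equivExterior`), and
left multiplication gives `θ` with `θ(v)² = q(v)·1` (`exists_linearMap_sq_eq`); finally the
identity `(∑ Xₖ Cₖ)² = P · 1` holds in `Mat_D(ℚ[X])` because it holds at every rational point
(`MvPolynomial.funext`), and is then specialised to any `ℚ`-algebra.  Everything is proved; no
named facts.  Not here: the rank statement ("multiple de `2^{m-1}`") and injectivity of `θ`, which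
the deduction of Théorème 0.2 does not need.

## References

* [RoyWaldschmidt1997ENS] D. Roy, M. Waldschmidt, Ann. Sci. ÉNS (4) 30 (1997) 753–796,
  §7 (ii) Lemme 7.6, p. 793 (lit key paper:doi-10-1016-s0012-9593-97-89938-7, PDF p. 42).
-/

noncomputable section

open MvPolynomial Finsupp

namespace Literature.NumberTheory.Transcendental

namespace RoyWaldschmidt1997

variable {n : ℕ}

/-! ### Monomials of degree two -/

/-- A monomial exponent of degree `2` is `Xᵢ Xⱼ` for some `i, j` (possibly equal). [folklore] -/
theorem exists_eq_single_add_single {σ : Type*} (m : σ →₀ ℕ) (hm : m.degree = 2) :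
    ∃ i j : σ, m = Finsupp.single i 1 + Finsupp.single j 1 := by
  classical
  have hcard : Multiset.card (Finsupp.toMultiset m) = 2 := by
    rw [Finsupp.card_toMultiset]
    simpa [Finsupp.degree, Finsupp.sum] using hm
  obtain ⟨x, y, hxy⟩ := Multiset.card_eq_two.mp hcard
  refine ⟨x, y, ?_⟩
  calc m = Multiset.toFinsupp (Finsupp.toMultiset m) := (Finsupp.toMultiset_toFinsupp m).symm
    _ = Multiset.toFinsupp ({x} + {y}) := by
        rw [hxy, Multiset.insert_eq_cons, ← Multiset.singleton_add]
    _ = Finsupp.single x 1 + Finsupp.single y 1 := by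
        rw [Multiset.toFinsupp_add, Multiset.toFinsupp_singleton, Multiset.toFinsupp_singleton]

/-- For a homogeneous polynomial of degree `2`, a choice of the pair of indices `(i_m, j_m)` of
each monomial `m = X_{i_m} X_{j_m}` of its support. [folklore] -/
theorem exists_pairs (P : MvPolynomial (Fin n) ℚ) (hP : P.IsHomogeneous 2) :
    ∃ ij : P.support → Fin n × Fin n,
      ∀ m : P.support, (m : Fin n →₀ ℕ) = Finsupp.single (ij m).1 1 + Finsupp.single (ij m).2 1 := by
  have key : ∀ m : P.support, ∃ p : Fin n × Fin n,
      (m : Fin n →₀ ℕ) = Finsupp.single p.1 1 + Finsupp.single p.2 1 := by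
    rintro ⟨m, hm⟩
    have hdeg : m.degree = 2 := by
      have h := hP (MvPolynomial.mem_support_iff.mp hm)
      rw [Finsupp.degree_eq_weight_one]
      exact h
    obtain ⟨i, j, h⟩ := exists_eq_single_add_single m hdeg
    exact ⟨(i, j), h⟩
  choose ij hij using key
  exact ⟨ij, hij⟩

/-- **Evaluation of a homogeneous quadratic polynomial**: with the pairs of `exists_pairs`,
`P(w) = ∑_{m ∈ supp P} c_m · w_{i_m} w_{j_m}` in any commutative `ℚ`-algebra. [folklore] -/
theorem aeval_eq_sum_pairs {A : Type*} [CommSemiring A] [Algebra ℚ A] (P : MvPolynomial (Fin n) ℚ)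
    (ij : P.support → Fin n × Fin n)
    (hij : ∀ m : P.support, (m : Fin n →₀ ℕ) = Finsupp.single (ij m).1 1 + Finsupp.single (ij m).2 1)
    (w : Fin n → A) :
    aeval w P = ∑ m : P.support, coeff (m : Fin n →₀ ℕ) P • (w (ij m).1 * w (ij m).2) := by
  conv_lhs => rw [P.as_sum, map_sum]
  rw [← Finset.sum_coe_sort]
  refine Finset.sum_congr rfl fun m _ => ?_
  rw [aeval_monomial, hij m, Finsupp.prod_add_index', Finsupp.prod_single_index,
    Finsupp.prod_single_index, pow_one, pow_one, Algebra.smul_def]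
  · exact pow_zero _
  · exact pow_zero _
  · intro a; exact pow_zero _
  · intro a b₁ b₂; exact pow_add _ _ _

/-- **A homogeneous polynomial of degree `2` over `ℚ` is a quadratic form on `ℚⁿ`**: there is a
`QuadraticForm ℚ ℚⁿ` with `q(v) = P(v)`. [folklore] -/
theorem exists_quadraticForm (P : MvPolynomial (Fin n) ℚ) (hP : P.IsHomogeneous 2) :
    ∃ q : QuadraticForm ℚ (Fin n → ℚ), ∀ v, q v = eval v P := by
  obtain ⟨ij, hij⟩ := exists_pairs P hP
  refine ⟨∑ m : P.support, coeff (m : Fin n →₀ ℕ) P • QuadraticMap.proj (ij m).1 (ij m).2, fun v => ?_⟩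
  have h := aeval_eq_sum_pairs P ij hij v
  rw [show aeval v P = eval v P from rfl] at h
  rw [h, QuadraticMap.sum_apply]
  refine Finset.sum_congr rfl fun m _ => ?_
  rw [QuadraticMap.smul_apply, QuadraticMap.proj_apply, smul_eq_mul]

/-! ### The Clifford representation -/

/-- **Roy–Waldschmidt 1997, Lemme 7.6 (the square-root property)**: for a quadratic form `q` on
`ℚⁿ` there are `D ≥ 1` and a linear map `θ : ℚⁿ → Mat_D(ℚ)` with `θ(v)² = q(v)·1` — left
multiplication by `v` on the Clifford algebra of `q` (of dimension `D = 2ⁿ`) written in a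
`ℚ`-basis. [cite: RoyWaldschmidt1997ENS, §7 (ii) Lemme 7.6, p. 793] -/
theorem exists_linearMap_sq_eq (q : QuadraticForm ℚ (Fin n → ℚ)) :
    ∃ (D : ℕ) (θ : (Fin n → ℚ) →ₗ[ℚ] Matrix (Fin D) (Fin D) ℚ),
      0 < D ∧ ∀ v, θ v * θ v = q v • (1 : Matrix (Fin D) (Fin D) ℚ) := by
  classical
  haveI : Invertible (2 : ℚ) := invertibleOfNonzero two_ne_zero
  -- a `ℚ`-basis of the Clifford algebra, transported from the exterior algebra
  let Acl := CliffordAlgebra q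
  let β₀ : Module.Basis (Finset (Fin n)) ℚ Acl :=
    ((Pi.basisFun ℚ (Fin n)).ExteriorAlgebra).map (CliffordAlgebra.equivExterior q).symm
  let D := Fintype.card (Finset (Fin n))
  let e : Finset (Fin n) ≃ Fin D := Fintype.equivFin _
  let β : Module.Basis (Fin D) ℚ Acl := β₀.reindex e
  -- left multiplication, as matrices
  let T : Acl →ₐ[ℚ] Matrix (Fin D) (Fin D) ℚ :=
    (LinearMap.toMatrixAlgEquiv β).toAlgHom.comp (Algebra.lmul ℚ Acl)
  refine ⟨D, T.toLinearMap.comp (CliffordAlgebra.ι q), Fintype.card_pos, fun v => ?_⟩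
  change T (CliffordAlgebra.ι q v) * T (CliffordAlgebra.ι q v) = _
  rw [← map_mul, CliffordAlgebra.ι_sq_scalar, AlgHom.commutes, Algebra.algebraMap_eq_smul_one]

/-- Specialising the polynomial matrix `∑ₖ Xₖ Cₖ` along a ring map `f : ℚ[X] → B`. [folklore] -/
theorem mapMatrix_sum_X_smul {D : ℕ} (C : Fin n → Matrix (Fin D) (Fin D) ℚ) {B : Type*} [CommRing B]
    (f : MvPolynomial (Fin n) ℚ →+* B) :
    f.mapMatrix (∑ k, (X k : MvPolynomial (Fin n) ℚ) • (C k).map MvPolynomial.C) =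
      ∑ k, f (X k) • (C k).map (f.comp MvPolynomial.C) := by
  ext a b
  simp [Matrix.sum_apply, Matrix.map_apply]

/-- **Export form of Lemme 7.6 used for Théorème 0.2.** For `P ∈ ℚ[X₁,…,Xₙ]` homogeneous of degree
`2` there are `D ≥ 1` and rational `D × D` matrices `C₁, …, Cₙ` such that for every commutative
`ℚ`-algebra `A` and every `w ∈ Aⁿ`, `(∑ₖ wₖ Cₖ)² = P(w)·1` in `Mat_D(A)` — i.e. the linear map
`θ = ∑ₖ Xₖ Cₖ`, defined over `ℚ`, satisfies `θ(w)² = P(w)·1` at complex points too.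
[cite: RoyWaldschmidt1997ENS, §7 (ii) Lemme 7.6 and (7.3), p. 793] -/
theorem exists_matrices_sq_eq_aeval (P : MvPolynomial (Fin n) ℚ) (hP : P.IsHomogeneous 2) :
    ∃ (D : ℕ) (C : Fin n → Matrix (Fin D) (Fin D) ℚ), 0 < D ∧
      ∀ (A : Type*) [CommRing A] [Algebra ℚ A] (w : Fin n → A),
        (∑ k, w k • (C k).map (algebraMap ℚ A)) * (∑ k, w k • (C k).map (algebraMap ℚ A)) =
          aeval w P • (1 : Matrix (Fin D) (Fin D) A) := by
  classical
  obtain ⟨q, hq⟩ := exists_quadraticForm P hP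
  obtain ⟨D, θ, hD, hθ⟩ := exists_linearMap_sq_eq q
  let C : Fin n → Matrix (Fin D) (Fin D) ℚ := fun k => θ (Pi.single k 1)
  refine ⟨D, C, hD, ?_⟩
  -- `θ v = ∑ v_k C_k`
  have hθv : ∀ v : Fin n → ℚ, θ v = ∑ k, v k • C k := by
    intro v
    conv_lhs => rw [← Finset.univ_sum_single v]
    rw [map_sum]
    refine Finset.sum_congr rfl fun k _ => ?_
    rw [← map_smul]
    congr 1
    ext j
    simp [Pi.single_apply]
  -- the polynomial matrix `L = ∑ X_k C_k` satisfies `L² = P · 1`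
  let L : Matrix (Fin D) (Fin D) (MvPolynomial (Fin n) ℚ) :=
    ∑ k, (X k : MvPolynomial (Fin n) ℚ) • (C k).map MvPolynomial.C
  have hL : L * L = P • (1 : Matrix (Fin D) (Fin D) (MvPolynomial (Fin n) ℚ)) := by
    refine Matrix.ext fun a b => ?_
    apply MvPolynomial.funext
    intro v
    have h1 : (eval v).mapMatrix (L * L) = (eval v).mapMatrix (P • 1) := by
      rw [map_mul, mapMatrix_sum_X_smul C (eval v)]
      have hC : ∀ k, (C k).map ((eval v).comp MvPolynomial.C) = C k := by
        intro k; ext a b; simp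
      simp only [hC, eval_X]
      rw [← hθv v, hθ v, hq v]
      ext i j
      simp only [Matrix.smul_apply, Matrix.one_apply, RingHom.mapMatrix_apply, Matrix.map_apply,
        smul_eq_mul, mul_ite, mul_one, mul_zero]
      split_ifs <;> simp
    have := congrFun (congrFun h1 a) b
    simpa [Matrix.map_apply] using this
  intro A _ _ w
  set f : MvPolynomial (Fin n) ℚ →+* A := (aeval w : MvPolynomial (Fin n) ℚ →ₐ[ℚ] A).toRingHom
    with hf
  have h2 := congrArg f.mapMatrix hL
  rw [map_mul, mapMatrix_sum_X_smul C f] at h2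
  have hC : ∀ k, (C k).map (f.comp MvPolynomial.C) = (C k).map (algebraMap ℚ A) := by
    intro k; ext a b; simp [hf]
  have hX : ∀ k, f (X k) = w k := fun k => by simp [hf]
  simp only [hC, hX] at h2
  rw [h2]
  ext a b
  simp only [hf, Matrix.smul_apply, Matrix.one_apply, RingHom.mapMatrix_apply, Matrix.map_apply,
    smul_eq_mul, mul_ite, mul_one, mul_zero]
  split_ifs <;> simp

end RoyWaldschmidt1997

end Literature.NumberTheory.Transcendental
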